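import Summits.AtomisticToContinuum.FouriersLaw.Theorems.PhononMeanFreePathCoherentDephasingLocalFGR

/-!
# Line `Sketch` of crux `PhononMeanFreePath.CoherentDephasing` (stmt-AtomisticToContinuum-11810): geometric decay of the far-bath dissipation from BULK passivity, a bulk local FGR bound, a head bound and a contact bound

Helper file (pure real analysis over `ℕ`-indexed real families) generalising
`Theorems/PhononMeanFreePathCoherentDephasingSitewiseComposition.lean`: the sitewise hypotheses are only asked in the
BULK, away from both baths, and the two contacts enter through one-sided bounds — the shape the molecular-dynamics
profiles of the ideators support (sitewise absorption `≥ 0` at every resolvable bulk site, but a slightly EMITTING far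
contact: at `(ω₂,lam,β,γ,T) = (1,1,1,1,1)`, `N = 24`, `γ∫m_N² ≈ 1.4 × Ĵ_{N-1}`, kit j010255).

Sites `0..N`, bonds `0..N-1`; `J b` the time-integrated symmetric harmonic coherent flux through bond `b`, `s x` the site
work, `E x ≥ 0` the time-integrated coherent site energy, `D = γ∫₀^∞ m_N²`. With margins `K + 1 ≤ L`, a block length
`L₀ ≥ 1` and `N ≥ 2L + 1`, assume

* head bound: `J L ≤ B` (the flux entering the bulk at depth `L` is bounded — uniformly in `N` in the application);
* site balances `J (x-1) - J x = s x` and PASSIVITY `0 ≤ s x` on the sites `L < x ≤ N - K`;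
* local FGR `κ E x ≤ s x` on `L < x ≤ N - L`, transport `J b ≤ E b + E (b+1)` on `L < b < N - L`;
* contact bound: `D ≤ (1 + C) · J (N - K - 1)` (the last `K + 1` sites and the far bath return at most `C ×` the flux
  entering them).

Then `D ≤ (1 + C) · B · θ^{(N - 2L)/L₀}` with the `N`-free ratio `θ = 2/(κ(L₀ - 1) + 2)` of `blockLaw_of_localFGR`
(`dissipation_le_geometric_bulk`). With `tendsto_natMul_pow_div` this is `N · D_N → 0`.
-/

noncomputable section

open Finset

namespace Summit.AtomisticToContinuum.FouriersLaw.Theorems.CoherentDephasing.BulkComposition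

open Summit.AtomisticToContinuum.FouriersLaw.Theorems.CoherentDephasing.LocalFGR

/-- [folklore] **Geometric decay of the far-bath dissipation from bulk passivity + bulk local FGR + head and contact
bounds.** See the module docstring. -/
theorem dissipation_le_geometric_bulk :
    ∀ (J s E : ℕ → ℝ) (D B C κ : ℝ) (N L L₀ K : ℕ), 0 < κ → 0 < L₀ → K + 1 ≤ L → 2 * L + 1 ≤ N → 0 ≤ C → 0 ≤ D →
      J L ≤ B → (∀ x, L < x → x + K ≤ N → J (x - 1) - J x = s x) → (∀ x, L < x → x + K ≤ N → 0 ≤ s x) →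
      (∀ x, L < x → x + L ≤ N → κ * E x ≤ s x) → (∀ x, 0 ≤ E x) →
      (∀ b, L < b → b + L < N → J b ≤ E b + E (b + 1)) → D ≤ (1 + C) * J (N - K - 1) →
      D ≤ (1 + C) * B * (2 / (κ * ((L₀ - 1 : ℕ) : ℝ) + 2)) ^ ((N - 2 * L) / L₀) := by
  intro J s E D B C κ N L L₀ K hκ hL₀ hKL hN hC hD hhead hbal hpass hfgr hE htr hcontact
  set θ : ℝ := 2 / (κ * ((L₀ - 1 : ℕ) : ℝ) + 2) with hθ
  have hθ0 : 0 ≤ θ := by rw [hθ]; positivity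
  set k : ℕ := (N - 2 * L) / L₀ with hk
  have hkL : k * L₀ ≤ N - 2 * L := by rw [hk]; exact Nat.div_mul_le_self _ _
  -- the flux is non-increasing on the bonds `L ≤ b ≤ b' ≤ N - K - 1`
  have hanti : ∀ b b' : ℕ, L ≤ b → b ≤ b' → b' + K + 1 ≤ N → J b' ≤ J b := fun b b' h0 h1 h2 =>
    flux_antitone_of_passive J s b b' (fun x hx1 hx2 => hbal x (by omega) (by omega))
      (fun x hx1 hx2 => hpass x (by omega) (by omega)) b le_rfl h1
  -- all these fluxes are `≥ D/(1+C) ≥ 0`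
  have hC1 : 0 < 1 + C := by linarith
  have hJend : 0 ≤ J (N - K - 1) := by
    have : 0 ≤ (1 + C) * J (N - K - 1) := hD.trans hcontact
    nlinarith
  have hJnn : ∀ b : ℕ, L ≤ b → b + K + 1 ≤ N → 0 ≤ J b := fun b h1 h2 =>
    hJend.trans (hanti b (N - K - 1) h1 (by omega) (by omega))
  -- one bulk block `(c, c + L₀]` with `L ≤ c`, `c + L₀ + L ≤ N`
  have hblock : ∀ c : ℕ, L ≤ c → c + L₀ + L ≤ N → J (c + L₀) ≤ θ * J c := by
    intro c hc1 hc2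
    have hb := blockLaw_of_localFGR J s E κ L₀ c (c + L₀) hκ hL₀ le_rfl
      (fun x h1 h2 => hbal x (by omega) (by omega)) (fun x h1 h2 => hpass x (by omega) (by omega))
      (fun x h1 h2 => hfgr x (by omega) (by omega)) hE (fun b'' h1 h2 => htr b'' (by omega) (by omega))
    rw [max_eq_left (hJnn c hc1 (by omega))] at hb
    rw [hθ]; linarith
  -- iterate over the `k` blocks starting at bond `L`
  have hiter : ∀ i : ℕ, i ≤ k → J (L + i * L₀) ≤ θ ^ i * J L := by
    intro i
    induction i with
    | zero => intro; simp
    | succ i ih =>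
      intro hi
      have hroom : L + i * L₀ + L₀ + L ≤ N := by
        have : (i + 1) * L₀ ≤ k * L₀ := Nat.mul_le_mul_right _ hi
        rw [Nat.add_mul, one_mul] at this
        omega
      have h1 := hblock (L + i * L₀) (by omega) hroom
      have h2 := ih (by omega)
      have e : L + (i + 1) * L₀ = L + i * L₀ + L₀ := by ring
      rw [e, pow_succ]
      calc J (L + i * L₀ + L₀) ≤ θ * J (L + i * L₀) := h1
        _ ≤ θ * (θ ^ i * J L) := mul_le_mul_of_nonneg_left h2 hθ0
        _ = θ ^ i * θ * J L := by ring
  -- conclude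
  have hθk : 0 ≤ θ ^ k := pow_nonneg hθ0 k
  have hlast : J (N - K - 1) ≤ J (L + k * L₀) := hanti (L + k * L₀) (N - K - 1) (by omega) (by omega) (by omega)
  calc D ≤ (1 + C) * J (N - K - 1) := hcontact
    _ ≤ (1 + C) * (θ ^ k * J L) := mul_le_mul_of_nonneg_left (hlast.trans (hiter k le_rfl)) hC1.le
    _ ≤ (1 + C) * (θ ^ k * B) := mul_le_mul_of_nonneg_left (mul_le_mul_of_nonneg_left hhead hθk) hC1.le
    _ = (1 + C) * B * θ ^ k := by ring

end Summit.AtomisticToContinuum.FouriersLaw.Theorems.CoherentDephasing.BulkComposition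

end
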